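import Mathlib.Algebra.Polynomial.Coeff
import Mathlib.Data.ZMod.Basic
import Mathlib.RingTheory.Ideal.Operations
import Mathlib.RingTheory.Ideal.Span
import Mathlib.Tactic.LinearCombination
import HarnessLib

set_option autoImplicit false

-- the summit and its single problem are both named BirchSwinnertonDyer (registry layout D-0017)
set_option linter.dupNamespace false

/-!
# Stub `stub_testCocyclePkX9` (hG1ᵍ of the graded core, line `graded_euler_loss` of crux
# `KatoDivisibilityX9` = stmt-BirchSwinnertonDyer-20547): the MODULE-THEORETIC OBSTRUCTION to the registered
# form — kernel-checked on the `Λ/p²`-module `𝔞 = (p, T)` (helper, `--supports 20547`; closes nothing)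

Worker file of seat `bsd-line-k6-p4` (g5 wave 1, stub worker of `stub_testCocyclePkX9`).  THEOREMS ONLY (pure
commutative algebra over `(ℤ/p²)[X]`); nothing is asserted about any curve.

WHY THIS FILE.  Under the dictionary `H¹(ℚ, 𝒯^{(k)}_L(E, κ⁻¹)) ≅ H¹(ℚ_∞, E[p^k])[(conj_γ − 1)^L]`
(inflation–restriction, `E(ℚ_∞)[p] = 0`; `shiftH1 ↔ conj_γ − 1`, `ι_* ↔` inclusion, `ShiftEmbed ↔` inclusion,
`Truncate ↔ ·T^{L−L'}`), the registered stub `stub_testCocyclePkX9` at `(d, J)` reads, on the Pontryagin dual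
`X₀` of the (relaxed) fine Selmer group `Sel₀(ℚ_∞, E[p^∞])` (a `Λ`-module, `T = γ − 1`):
* hypothesis («`ι_N y = p^d t`, `t ∈ Sel₀`, `T^J y ≠ 0`»)      ⟺  `p^d T^J · (X₀ / p^{d+1} X₀) ≠ 0`;
* conclusion (i) ∧ (ii) («`Ψ` of level `J+1` with `p^d Ψ = ι_* ψ̄`, `T^J ψ̄ ≠ 0`»), for `J ≥ ε` (where (iii) ∧ (iv)
  force `T^ε Ψ` into the fine part)                            ⟹  `p^d T^{J'} · (X₀ / (p^{d+1}, T^{J'+1}) X₀) ≠ 0`,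
  `J' = J − ε`.
This file checks that for the finitely generated torsion `Λ`-module `X₀ = 𝔞 := (p, T) ⊂ Λ/p²` (`μ = 2`,
characteristic ideal `(p²)`, no non-zero finite submodule, pseudo-isomorphic to `Λ/p²`) and `d = 1` the first
holds at EVERY `J` (`testPairHypothesis_idealPX`) while the second fails at EVERY `J'`
(`testClassConclusion_fails_idealPX`: `p X^{J} 𝔞 ⊆ X^{J+1} 𝔞`).  Hence the registered implication is not a
consequence of its hypothesis by any argument that does not also exclude this module shape for `X₀` on class
X9 (an open, Conjecture-A-type statement); in particular it is NOT the port of the `d = 0` stub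
`stub_selmerDualOdd` (where `t = y` and the avatar `T^{m−J−1} y` repairs the `T`-order).  The worker's notes
(`work/stubs/StubTestCocyclePkX9.notes.md`) give the corrected (exact-test-pair) signature.

We work in `R = (ℤ/p²)[X]` (the image of `Λ → Λ/(p²)`, `T ↦ X`); `𝔞 = Ideal.span {C p, X}`.

References: L. Washington, *Introduction to Cyclotomic Fields* §13.2 (structure of `Λ`-modules, `μ`-invariant)
[Washington1997]; B. Mazur, K. Rubin, Mem. AMS 799 (2004) §5.3 (the modules `T ⊗ Λ/(p^k, T^J)`) [MazurRubin2004].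
-/

noncomputable section

open Polynomial

namespace Summit.BirchSwinnertonDyer.BirchSwinnertonDyer.Theorems.OneSidedTwistSqueezeX9KatoDivisibilityX9StubTestCocyclePkX9Obstruction

variable (p : ℕ) [Fact p.Prime]

/-- `p ≠ 0` in `ℤ/p²`. [folklore] -/
theorem natCast_prime_ne_zero_zmod_sq : ((p : ℕ) : ZMod (p ^ 2)) ≠ 0 := by
  have hp : p.Prime := Fact.out
  rw [Ne, ZMod.natCast_eq_zero_iff]
  intro h
  have h1 : p ^ 2 ≤ p ^ 1 := by simpa using Nat.le_of_dvd hp.pos h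
  have h2 := (Nat.pow_le_pow_iff_right hp.one_lt).1 h1
  omega

omit [Fact p.Prime] in
/-- `p · p = 0` in `ℤ/p²`, hence `C p * C p = 0` in `(ℤ/p²)[X]`. [folklore] -/
theorem C_prime_mul_C_prime_eq_zero :
    (C ((p : ℕ) : ZMod (p ^ 2)) : (ZMod (p ^ 2))[X]) * C ((p : ℕ) : ZMod (p ^ 2)) = 0 := by
  rw [← C_mul, ← Nat.cast_mul, ← pow_two, ZMod.natCast_self, C_0]

/-- **The test-pair HYPOTHESIS of `stub_testCocyclePkX9` holds at every `J` on `X₀ = 𝔞 = (p, X) ⊂ (ℤ/p²)[X]`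
(`d = 1`)**: `p · X^J` does not annihilate `𝔞 = 𝔞 / p²𝔞` — witness `X ∈ 𝔞`, `p X^J · X = p X^{J+1} ≠ 0`.
(Dually: `Sel₀[p²] = 𝔞^∨` contains `t` with `(γ−1)^J · p t ≠ 0`.) [cite: Washington1997, §13.2] -/
theorem testPairHypothesis_idealPX (J : ℕ) :
    ∃ x ∈ Ideal.span ({C ((p : ℕ) : ZMod (p ^ 2)), X} : Set (ZMod (p ^ 2))[X]),
      C ((p : ℕ) : ZMod (p ^ 2)) * X ^ J * x ≠ 0 := by
  refine ⟨X, Ideal.subset_span (by simp), fun h => ?_⟩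
  have hc := congrArg (fun q : (ZMod (p ^ 2))[X] => q.coeff (J + 1)) h
  simp only [mul_assoc, ← pow_succ, coeff_C_mul, coeff_X_pow, if_true, mul_one, coeff_zero] at hc
  exact natCast_prime_ne_zero_zmod_sq p hc

omit [Fact p.Prime] in
/-- **The test-class CONCLUSION (i) ∧ (ii) of `stub_testCocyclePkX9` fails at every `J` on `X₀ = 𝔞 = (p, X)`
(`d = 1`)**: `p X^J · 𝔞 ⊆ X^{J+1} · 𝔞` (`= (p², X^{J+1}) 𝔞` as `p² = 0`), i.e. `p X^J` annihilates
`𝔞 / (p², X^{J+1}) 𝔞` — for `a = α p + β X ∈ 𝔞`, `p X^J a = X^{J+1} · (p β)` with `p β ∈ 𝔞`.  (Dually: no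
`Ψ ∈ 𝔞^∨` with `(γ−1)^{J+1} Ψ = 0` and `(γ−1)^J · p Ψ ≠ 0`.) [cite: Washington1997, §13.2]
[cite: MazurRubin2004, §5.3] -/
theorem testClassConclusion_fails_idealPX (J : ℕ) {x : (ZMod (p ^ 2))[X]}
    (hx : x ∈ Ideal.span ({C ((p : ℕ) : ZMod (p ^ 2)), X} : Set (ZMod (p ^ 2))[X])) :
    C ((p : ℕ) : ZMod (p ^ 2)) * X ^ J * x ∈
      Ideal.span ({X ^ (J + 1)} : Set (ZMod (p ^ 2))[X]) *
        Ideal.span ({C ((p : ℕ) : ZMod (p ^ 2)), X} : Set (ZMod (p ^ 2))[X]) := by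
  obtain ⟨α, β, rfl⟩ := Ideal.mem_span_pair.1 hx
  have h : C ((p : ℕ) : ZMod (p ^ 2)) * X ^ J * (α * C ((p : ℕ) : ZMod (p ^ 2)) + β * X) =
      X ^ (J + 1) * (β * C ((p : ℕ) : ZMod (p ^ 2))) := by
    have h0 := C_prime_mul_C_prime_eq_zero p
    linear_combination (α * X ^ J) * h0
  rw [h]
  exact Ideal.mul_mem_mul (Ideal.subset_span rfl)
    (Ideal.mul_mem_left _ _ (Ideal.subset_span (by simp)))

/-- **Both at once (the obstruction, packaged)**: on `𝔞 = (p, X) ⊂ (ℤ/p²)[X]` the hypothesis of the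
registered `stub_testCocyclePkX9` (dual form, `d = 1`) holds at every `J` while its conclusion (dual form)
fails at every `J`. [cite: Washington1997, §13.2] -/
theorem testCocyclePk_obstruction_idealPX (J : ℕ) :
    (∃ x ∈ Ideal.span ({C ((p : ℕ) : ZMod (p ^ 2)), X} : Set (ZMod (p ^ 2))[X]),
      C ((p : ℕ) : ZMod (p ^ 2)) * X ^ J * x ≠ 0) ∧
    (∀ x ∈ Ideal.span ({C ((p : ℕ) : ZMod (p ^ 2)), X} : Set (ZMod (p ^ 2))[X]),
      C ((p : ℕ) : ZMod (p ^ 2)) * X ^ J * x ∈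
        Ideal.span ({X ^ (J + 1)} : Set (ZMod (p ^ 2))[X]) *
          Ideal.span ({C ((p : ℕ) : ZMod (p ^ 2)), X} : Set (ZMod (p ^ 2))[X])) :=
  ⟨testPairHypothesis_idealPX p J, fun _ hx => testClassConclusion_fails_idealPX p J hx⟩

end Summit.BirchSwinnertonDyer.BirchSwinnertonDyer.Theorems.OneSidedTwistSqueezeX9KatoDivisibilityX9StubTestCocyclePkX9Obstruction

end
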